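import Summits.Ventures.HodgeRepro2.T5BergmanMonomialNorm
import Summits.Ventures.HodgeRepro2.T5CircleParseval

/-!
# Parseval's identity in the weighted Bergman space: `(5-98)` is an orthonormal BASIS

For a power series `f(z) = Σ_n a_n zⁿ` converging on the open unit disc and `k ≥ 2`:

  `∫⁻_𝔻 |f|² (1 - |z|²)^{k-2} dA = Σ_n |a_n|² ⟨zⁿ, zⁿ⟩_k`    (in `[0, ∞]`, no integrability assumed)

(`lintegral_sq_weight_eq_tsum`): polar coordinates (`Complex.lintegral_comp_polarCoord_symm`), Tonelli,
Parseval on each circle (`T5CircleParseval.hasSum_circle_parseval`), monotone convergence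
(`lintegral_tsum`) and the norms `⟨zⁿ, zⁿ⟩_k = π n! (k-2)! / (n+k-1)!` of `T5BergmanMonomialNorm`.
Consequences:

* **the `ℓ²`-characterisation** of the weighted Bergman space: `|f|² w` is integrable on `𝔻` iff
  `Σ_n |a_n|² ⟨zⁿ, zⁿ⟩_k < ∞` (`integrableOn_iff_summable`), and then
  `⟨f, f⟩_k = Σ_n |a_n|² ⟨zⁿ, zⁿ⟩_k` (`hasSum_pairing_self`);
* **density of the polynomials / completeness of the orthogonal system**: the Taylor partial sums
  `S_N = Σ_{n<N} a_n zⁿ` converge to `f` in the pairing norm, `⟨f - S_N, f - S_N⟩_k = Σ_{n≥N} |a_n|² ⟨zⁿ,zⁿ⟩_k → 0`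
  (`tendsto_pairing_sub_partialSum`).

So Rühl's `(5-98)/(5-99)` `Φ_q = N_q^k w^{q-k}` is an orthonormal BASIS of the weighted Bergman space
(`T5BergmanMonomialNorm.ruhlInner_basis` + density), not only an orthonormal system.

Blind lane: Mathlib + the HodgeRepro2 prefix only; no sorry; axioms ⊆ {propext, Classical.choice,
Quot.sound}.
-/

namespace Summit.Ventures.HodgeRepro2.T5BergmanParseval

open MeasureTheory Metric Filter Topology T5BergmanCoefficient T5BergmanPairing T5BergmanMonomialNorm
  T5CircleParseval
open scoped Real ENNReal NNReal Nat

/-! ### The disc `lintegral` in polar coordinates (Tonelli form) -/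

/-- `Complex.polarCoord.symm (r, θ) = circleMap 0 r θ`. -/
lemma polarCoord_symm_eq_circleMap (r θ : ℝ) :
    Complex.polarCoord.symm (r, θ) = circleMap 0 r θ := by
  rw [Complex.polarCoord_symm_apply, circleMap, zero_add, Complex.exp_mul_I]
  push_cast
  ring_nf

/-- **The disc `lintegral` in polar coordinates, Tonelli form**: for `F ≥ 0` continuous on `𝔻`,
`∫⁻_𝔻 F dA = ∫⁻_{r ∈ (0,1)} ∫⁻_{θ ∈ (-π,π)} r F(r e^{iθ}) dθ dr`. -/
theorem lintegral_ball_eq_polar (F : ℂ → ℝ) (hF : ContinuousOn F (ball 0 1)) :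
    ∫⁻ z in ball (0 : ℂ) 1, ENNReal.ofReal (F z) =
      ∫⁻ r in Set.Ioo (0 : ℝ) 1, ∫⁻ θ in Set.Ioo (-π) π, ENNReal.ofReal (r * F (circleMap 0 r θ)) := by
  set G : ℂ → ℝ≥0∞ := (ball (0 : ℂ) 1).indicator fun z => ENNReal.ofReal (F z) with hG
  have key := Complex.lintegral_comp_polarCoord_symm G
  rw [hG, lintegral_indicator measurableSet_ball] at key
  rw [← key, polarCoord_target]
  have e : ∀ q ∈ Set.Ioi (0 : ℝ) ×ˢ Set.Ioo (-π) π,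
      ENNReal.ofReal q.1 • (ball (0 : ℂ) 1).indicator (fun z => ENNReal.ofReal (F z))
        (Complex.polarCoord.symm q) =
      (Set.Ioo (0 : ℝ) 1 ×ˢ Set.Ioo (-π) π).indicator
        (fun q : ℝ × ℝ => ENNReal.ofReal (q.1 * F (circleMap 0 q.1 q.2))) q := by
    rintro ⟨r, θ⟩ ⟨hr, hθ⟩
    simp only [Set.mem_Ioi] at hr
    rw [polarCoord_symm_eq_circleMap]
    have hn : ‖circleMap 0 r θ‖ = r := by rw [norm_circleMap_zero, abs_of_pos hr]
    by_cases h1 : r < 1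
    · have hmem : circleMap 0 r θ ∈ ball (0 : ℂ) 1 := by rw [mem_ball_zero_iff, hn]; exact h1
      rw [Set.indicator_of_mem hmem, Set.indicator_of_mem
        (show (r, θ) ∈ Set.Ioo (0 : ℝ) 1 ×ˢ Set.Ioo (-π) π from ⟨⟨hr, h1⟩, hθ⟩), smul_eq_mul,
        ← ENNReal.ofReal_mul hr.le]
    · have hmem : circleMap 0 r θ ∉ ball (0 : ℂ) 1 := by rw [mem_ball_zero_iff, hn]; exact h1
      rw [Set.indicator_of_notMem hmem, Set.indicator_of_notMem
        (show (r, θ) ∉ Set.Ioo (0 : ℝ) 1 ×ˢ Set.Ioo (-π) π from fun h => h1 h.1.2), smul_zero]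
  rw [setLIntegral_congr_fun (measurableSet_Ioi.prod measurableSet_Ioo) e,
    lintegral_indicator (measurableSet_Ioo.prod measurableSet_Ioo),
    Measure.restrict_restrict (measurableSet_Ioo.prod measurableSet_Ioo),
    Set.inter_eq_left.mpr (Set.prod_mono Set.Ioo_subset_Ioi_self le_rfl)]
  -- Tonelli
  have hmaps : Set.MapsTo (fun q : ℝ × ℝ => circleMap 0 q.1 q.2)
      (Set.Ioo (0 : ℝ) 1 ×ˢ Set.Ioo (-π) π) (ball (0 : ℂ) 1) := by
    rintro ⟨r, θ⟩ ⟨hr, _⟩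
    rw [mem_ball_zero_iff, norm_circleMap_zero, abs_of_pos hr.1]
    exact hr.2
  have hcont : ContinuousOn (fun q : ℝ × ℝ => q.1 * F (circleMap 0 q.1 q.2))
      (Set.Ioo (0 : ℝ) 1 ×ˢ Set.Ioo (-π) π) :=
    continuous_fst.continuousOn.mul (hF.comp continuous_pol.continuousOn hmaps)
  have hmeas : AEMeasurable (fun q : ℝ × ℝ => ENNReal.ofReal (q.1 * F (circleMap 0 q.1 q.2)))
      (volume.restrict (Set.Ioo (0 : ℝ) 1 ×ˢ Set.Ioo (-π) π)) :=
    ENNReal.measurable_ofReal.comp_aemeasurable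
      (hcont.aemeasurable (measurableSet_Ioo.prod measurableSet_Ioo))
  rw [Measure.volume_eq_prod, ← Measure.prod_restrict] at hmeas ⊢
  exact lintegral_prod _ hmeas

/-! ### Parseval in the weighted Bergman space -/

/-- A power series converging on `𝔻` is continuous on `𝔻`. -/
lemma continuousOn_ball (a : ℕ → ℂ) (f : ℂ → ℂ)
    (hf : ∀ z ∈ ball (0 : ℂ) 1, HasSum (fun n => a n * z ^ n) (f z)) :
    ContinuousOn f (ball (0 : ℂ) 1) := by
  intro z hz
  have hr : ‖z‖ < 1 := mem_ball_zero_iff.mp hz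
  have h1 : closedBall (0 : ℂ) ((1 + ‖z‖) / 2) ∈ 𝓝 z :=
    closedBall_mem_nhds_of_mem (by rw [mem_ball_zero_iff]; linarith)
  exact ((continuousOn_closedBall a f hf (by positivity) (by linarith)).continuousAt h1).continuousWithinAt

/-- The squared norm of the monomial `zⁿ`, `⟨zⁿ, zⁿ⟩_k = π n! (k-2)! / (n+k-1)!`, as a real constant. -/
noncomputable abbrev monomialNormSq (k n : ℕ) : ℝ := π * ((n ! : ℝ) * (k - 2)!) / (n + k - 1)!

/-- `monomialNormSq k n > 0`. -/
lemma monomialNormSq_pos (k n : ℕ) : 0 < monomialNormSq k n := by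
  unfold monomialNormSq
  positivity

/-- The circle integral at radius `r ∈ (0,1)`: `∫⁻_{(-π,π)} r |f(re^{iθ})|² (1 - r²)^{k-2} dθ
= Σ_n 2π |a_n|² r^{2n+1} (1 - r²)^{k-2}` (Parseval on the circle). -/
lemma lintegral_circle (k : ℕ) (a : ℕ → ℂ) (f : ℂ → ℂ)
    (hf : ∀ z ∈ ball (0 : ℂ) 1, HasSum (fun n => a n * z ^ n) (f z)) {r : ℝ} (hr0 : 0 < r)
    (hr : r < 1) :
    ∫⁻ θ in Set.Ioo (-π) π,
        ENNReal.ofReal (r * (‖f (circleMap 0 r θ)‖ ^ 2 * (1 - ‖circleMap 0 r θ‖ ^ 2) ^ (k - 2))) =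
      ∑' n, ENNReal.ofReal (2 * π * ‖a n‖ ^ 2 * (r * ((r ^ 2) ^ n * (1 - r ^ 2) ^ (k - 2)))) := by
  have hn : ∀ θ : ℝ, ‖circleMap 0 r θ‖ = r := fun θ => by
    rw [norm_circleMap_zero, abs_of_pos hr0]
  simp_rw [hn]
  have hw0 : 0 ≤ r * (1 - r ^ 2) ^ (k - 2) := by
    have : 0 ≤ 1 - r ^ 2 := by nlinarith
    positivity
  have e : ∀ θ : ℝ, ENNReal.ofReal (r * (‖f (circleMap 0 r θ)‖ ^ 2 * (1 - r ^ 2) ^ (k - 2))) =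
      ENNReal.ofReal (r * (1 - r ^ 2) ^ (k - 2)) * ENNReal.ofReal (‖f (circleMap 0 r θ)‖ ^ 2) := by
    intro θ
    rw [← ENNReal.ofReal_mul hw0]
    congr 1
    ring
  simp_rw [e]
  rw [lintegral_const_mul' _ _ ENNReal.ofReal_ne_top]
  -- the circle integral as a Bochner integral
  have hcont : ContinuousOn (fun θ : ℝ => ‖f (circleMap 0 r θ)‖ ^ 2) (Set.Icc (-π) π) := by
    have hmaps : Set.MapsTo (circleMap 0 r) (Set.Icc (-π) π) (closedBall (0 : ℂ) r) := fun θ _ => by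
      rw [mem_closedBall_zero_iff, hn]
    exact (((continuousOn_closedBall a f hf hr0.le hr).comp (continuous_circleMap 0 r).continuousOn
      hmaps).norm.pow 2)
  have hint : IntegrableOn (fun θ : ℝ => ‖f (circleMap 0 r θ)‖ ^ 2) (Set.Ioo (-π) π) :=
    (hcont.integrableOn_Icc).mono_set Set.Ioo_subset_Icc_self
  rw [← ofReal_integral_eq_lintegral_ofReal hint (Eventually.of_forall fun θ => by positivity)]
  have hP := hasSum_circle_parseval a f hf hr0.le hr
  have hI : ∫ θ in Set.Ioo (-π) π, ‖f (circleMap 0 r θ)‖ ^ 2 =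
      2 * π * ∑' n, ‖a n‖ ^ 2 * (r ^ 2) ^ n := by
    rw [hP.tsum_eq]
    field_simp
  rw [hI, ← tsum_mul_left, ENNReal.ofReal_tsum_of_nonneg (fun n => by positivity)
    (hP.summable.mul_left _), ← ENNReal.tsum_mul_left]
  congr 1
  ext n
  rw [← ENNReal.ofReal_mul hw0]
  congr 1
  ring

/-- **Parseval's identity in the weighted Bergman space** (in `[0, ∞]`, no integrability assumed):
for a power series `f = Σ a_n zⁿ` converging on `𝔻` and `k ≥ 2`,
`∫⁻_𝔻 |f|² (1 - |z|²)^{k-2} dA = Σ_n |a_n|² ⟨zⁿ, zⁿ⟩_k`. -/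
theorem lintegral_sq_weight_eq_tsum (k : ℕ) (hk : 2 ≤ k) (a : ℕ → ℂ) (f : ℂ → ℂ)
    (hf : ∀ z ∈ ball (0 : ℂ) 1, HasSum (fun n => a n * z ^ n) (f z)) :
    ∫⁻ z in ball (0 : ℂ) 1, ENNReal.ofReal (‖f z‖ ^ 2 * (1 - ‖z‖ ^ 2) ^ (k - 2)) =
      ∑' n, ENNReal.ofReal (‖a n‖ ^ 2 * monomialNormSq k n) := by
  have hF : ContinuousOn (fun z : ℂ => ‖f z‖ ^ 2 * (1 - ‖z‖ ^ 2) ^ (k - 2)) (ball 0 1) :=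
    ((continuousOn_ball a f hf).norm.pow 2).mul (by fun_prop)
  rw [lintegral_ball_eq_polar _ hF]
  rw [setLIntegral_congr_fun measurableSet_Ioo
    (fun r hr => lintegral_circle k a f hf hr.1 hr.2)]
  have hmeas : ∀ n : ℕ, AEMeasurable (fun r : ℝ =>
      ENNReal.ofReal (2 * π * ‖a n‖ ^ 2 * (r * ((r ^ 2) ^ n * (1 - r ^ 2) ^ (k - 2)))))
      (volume.restrict (Set.Ioo (0 : ℝ) 1)) := fun n =>
    ((by fun_prop : Continuous fun r : ℝ =>
      2 * π * ‖a n‖ ^ 2 * (r * ((r ^ 2) ^ n * (1 - r ^ 2) ^ (k - 2)))).measurable.ennreal_ofReal).aemeasurable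
  rw [lintegral_tsum hmeas]
  congr 1
  ext n
  obtain ⟨m, rfl⟩ := Nat.exists_eq_add_of_le' hk
  have hint : IntegrableOn (fun r : ℝ => r * ((r ^ 2) ^ n * (1 - r ^ 2) ^ (m + 2 - 2)))
      (Set.Ioo (0 : ℝ) 1) :=
    ((by fun_prop : Continuous fun r : ℝ => r * ((r ^ 2) ^ n * (1 - r ^ 2) ^ (m + 2 - 2))).integrableOn_Icc).mono_set
      Set.Ioo_subset_Icc_self
  have hnn : 0 ≤ᵐ[volume.restrict (Set.Ioo (0 : ℝ) 1)]
      fun r : ℝ => r * ((r ^ 2) ^ n * (1 - r ^ 2) ^ (m + 2 - 2)) := by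
    rw [Filter.EventuallyLE, ae_restrict_iff' measurableSet_Ioo]
    exact Eventually.of_forall fun r hr => by
      have : 0 ≤ 1 - r ^ 2 := by nlinarith [hr.1, hr.2]
      exact mul_nonneg hr.1.le (mul_nonneg (by positivity) (pow_nonneg this _))
  have e : ∀ r : ℝ, ENNReal.ofReal (2 * π * ‖a n‖ ^ 2 * (r * ((r ^ 2) ^ n * (1 - r ^ 2) ^ (m + 2 - 2)))) =
      ENNReal.ofReal (2 * π * ‖a n‖ ^ 2) * ENNReal.ofReal (r * ((r ^ 2) ^ n * (1 - r ^ 2) ^ (m + 2 - 2))) :=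
    fun r => ENNReal.ofReal_mul (by positivity)
  simp_rw [e]
  rw [lintegral_const_mul' _ _ ENNReal.ofReal_ne_top,
    ← ofReal_integral_eq_lintegral_ofReal hint hnn, show m + 2 - 2 = m by omega,
    integral_Ioo_pow_mul_one_sub_sq_pow n m, ← ENNReal.ofReal_mul (by positivity)]
  congr 1
  unfold monomialNormSq
  rw [show n + (m + 2) - 1 = n + m + 1 by omega, show m + 2 - 2 = m by omega]
  have h1 : ((n + m + 1)! : ℝ) ≠ 0 := by positivity
  field_simp

/-! ### The `ℓ²`-characterisation of the space -/

/-- `|f|² w ≥ 0` a.e. on `𝔻`. -/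
lemma ae_nonneg_sq_weight (k : ℕ) (f : ℂ → ℂ) :
    0 ≤ᵐ[volume.restrict (ball (0 : ℂ) 1)] fun z => ‖f z‖ ^ 2 * (1 - ‖z‖ ^ 2) ^ (k - 2) := by
  rw [Filter.EventuallyLE, ae_restrict_iff' measurableSet_ball]
  exact Eventually.of_forall fun z hz => by
    have := mem_ball_zero_iff.mp hz
    have h0 : 0 ≤ 1 - ‖z‖ ^ 2 := by nlinarith [norm_nonneg z]
    positivity

/-- `Σ_n ofReal (g n) ≠ ∞ ⟹ Summable g` for `g ≥ 0`. -/
lemma summable_of_tsum_ofReal_ne_top {g : ℕ → ℝ} (hg : ∀ n, 0 ≤ g n)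
    (h : ∑' n, ENNReal.ofReal (g n) ≠ ⊤) : Summable g := by
  have h1 : Summable fun n => Real.toNNReal (g n) := ENNReal.tsum_coe_ne_top_iff_summable.mp h
  have h2 : Summable fun n => ((Real.toNNReal (g n) : ℝ≥0) : ℝ) := NNReal.summable_coe.mpr h1
  refine h2.congr fun n => ?_
  exact Real.coe_toNNReal _ (hg n)

/-- **The `ℓ²`-characterisation of the weighted Bergman space**: for a power series `f = Σ a_n zⁿ`
converging on `𝔻` and `k ≥ 2`, `|f|² (1 - |z|²)^{k-2}` is integrable on `𝔻` iff
`Σ_n |a_n|² ⟨zⁿ, zⁿ⟩_k < ∞`. -/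
theorem integrableOn_iff_summable (k : ℕ) (hk : 2 ≤ k) (a : ℕ → ℂ) (f : ℂ → ℂ)
    (hf : ∀ z ∈ ball (0 : ℂ) 1, HasSum (fun n => a n * z ^ n) (f z)) :
    IntegrableOn (fun z => ‖f z‖ ^ 2 * (1 - ‖z‖ ^ 2) ^ (k - 2)) (ball (0 : ℂ) 1) ↔
      Summable (fun n => ‖a n‖ ^ 2 * monomialNormSq k n) := by
  have hmeas : AEStronglyMeasurable (fun z : ℂ => ‖f z‖ ^ 2 * (1 - ‖z‖ ^ 2) ^ (k - 2))
      (volume.restrict (ball (0 : ℂ) 1)) :=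
    (((continuousOn_ball a f hf).norm.pow 2).mul (by fun_prop)).aestronglyMeasurable measurableSet_ball
  have hnn : ∀ n, 0 ≤ ‖a n‖ ^ 2 * monomialNormSq k n := fun n =>
    mul_nonneg (by positivity) (monomialNormSq_pos k n).le
  rw [IntegrableOn, Integrable, and_iff_right hmeas, hasFiniteIntegral_iff_ofReal (ae_nonneg_sq_weight k f),
    lintegral_sq_weight_eq_tsum k hk a f hf, lt_top_iff_ne_top]
  constructor
  · exact summable_of_tsum_ofReal_ne_top hnn
  · intro hs
    rw [← ENNReal.ofReal_tsum_of_nonneg hnn hs]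
    exact ENNReal.ofReal_ne_top

/-- **Parseval's identity for `⟨f, f⟩_k`**: for `f ∈ A_k` given by `Σ a_n zⁿ`,
`⟨f, f⟩_k = Σ_n |a_n|² ⟨zⁿ, zⁿ⟩_k` (as a `HasSum`). -/
theorem hasSum_pairing_self (k : ℕ) (hk : 2 ≤ k) (a : ℕ → ℂ) (f : ℂ → ℂ)
    (hf : ∀ z ∈ ball (0 : ℂ) 1, HasSum (fun n => a n * z ^ n) (f z))
    (hint : IntegrableOn (fun z => ‖f z‖ ^ 2 * (1 - ‖z‖ ^ 2) ^ (k - 2)) (ball (0 : ℂ) 1)) :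
    HasSum (fun n => ‖a n‖ ^ 2 * monomialNormSq k n) (pairing k f f).re := by
  have hs := (integrableOn_iff_summable k hk a f hf).mp hint
  have hnn : ∀ n, 0 ≤ ‖a n‖ ^ 2 * monomialNormSq k n := fun n =>
    mul_nonneg (by positivity) (monomialNormSq_pos k n).le
  convert hs.hasSum using 1
  rw [pairing_self_eq, Complex.ofReal_re, integral_eq_lintegral_of_nonneg_ae (ae_nonneg_sq_weight k f)
    hint.aestronglyMeasurable, lintegral_sq_weight_eq_tsum k hk a f hf,
    ← ENNReal.ofReal_tsum_of_nonneg hnn hs, ENNReal.toReal_ofReal (tsum_nonneg hnn)]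

/-! ### Density of the polynomials: the Taylor partial sums converge in norm -/

/-- The Taylor partial sum `S_N(z) = Σ_{n<N} a_n zⁿ`. -/
noncomputable abbrev partialSum (a : ℕ → ℂ) (N : ℕ) : ℂ → ℂ := fun z => ∑ n ∈ Finset.range N, a n * z ^ n

/-- `f - S_N` is the power series with coefficients `a_n` for `n ≥ N` and `0` for `n < N`. -/
lemma hasSum_sub_partialSum (a : ℕ → ℂ) (f : ℂ → ℂ)
    (hf : ∀ z ∈ ball (0 : ℂ) 1, HasSum (fun n => a n * z ^ n) (f z)) (N : ℕ) {z : ℂ}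
    (hz : z ∈ ball (0 : ℂ) 1) :
    HasSum (fun n => (if n < N then 0 else a n) * z ^ n) ((f - partialSum a N) z) := by
  have h1 : HasSum (fun n => if n < N then a n * z ^ n else 0)
      (∑ n ∈ Finset.range N, if n < N then a n * z ^ n else 0) :=
    hasSum_sum_of_ne_finset_zero (fun n hn => by
      rw [Finset.mem_range] at hn
      simp [hn])
  have h2 : (∑ n ∈ Finset.range N, if n < N then a n * z ^ n else 0) = partialSum a N z := by
    apply Finset.sum_congr rfl
    intro n hn
    rw [Finset.mem_range] at hn
    simp [hn]
  rw [h2] at h1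
  have h3 := (hf z hz).sub h1
  refine h3.congr_fun fun n => ?_
  by_cases hn : n < N <;> simp [hn]

/-- **Density of the polynomials in the weighted Bergman space**: for `f ∈ A_k` given by `Σ a_n zⁿ`,
the Taylor partial sums converge to `f` in the pairing norm, `⟨f - S_N, f - S_N⟩_k → 0`. -/
theorem tendsto_pairing_sub_partialSum (k : ℕ) (hk : 2 ≤ k) (a : ℕ → ℂ) (f : ℂ → ℂ)
    (hf : ∀ z ∈ ball (0 : ℂ) 1, HasSum (fun n => a n * z ^ n) (f z))
    (hint : IntegrableOn (fun z => ‖f z‖ ^ 2 * (1 - ‖z‖ ^ 2) ^ (k - 2)) (ball (0 : ℂ) 1)) :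
    Tendsto (fun N => (pairing k (f - partialSum a N) (f - partialSum a N)).re) atTop (𝓝 0) := by
  set g : ℕ → ℝ := fun n => ‖a n‖ ^ 2 * monomialNormSq k n with hg
  have hnn : ∀ n, 0 ≤ g n := fun n => mul_nonneg (by positivity) (monomialNormSq_pos k n).le
  have hs : Summable g := (integrableOn_iff_summable k hk a f hf).mp hint
  -- the norm of `f - S_N` as a tail sum
  have key : ∀ N, (pairing k (f - partialSum a N) (f - partialSum a N)).re =
      (∑' j, ENNReal.ofReal (g (j + N))).toReal := by
    intro N
    have hcont : ContinuousOn (f - partialSum a N) (ball (0 : ℂ) 1) :=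
      (continuousOn_ball a f hf).sub (by fun_prop : Continuous (partialSum a N)).continuousOn
    rw [pairing_self_eq, Complex.ofReal_re, integral_eq_lintegral_of_nonneg_ae (ae_nonneg_sq_weight k _)
      (((hcont.norm.pow 2).mul (by fun_prop)).aestronglyMeasurable measurableSet_ball),
      lintegral_sq_weight_eq_tsum k hk _ _ (fun z hz => hasSum_sub_partialSum a f hf N hz)]
    congr 1
    rw [← ENNReal.summable.sum_add_tsum_nat_add' (k := N)]
    have h0 : ∑ i ∈ Finset.range N, ENNReal.ofReal (‖(if i < N then 0 else a i)‖ ^ 2 * monomialNormSq k i)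
        = 0 := by
      apply Finset.sum_eq_zero
      intro i hi
      rw [Finset.mem_range] at hi
      simp [hi]
    rw [h0, zero_add]
    congr 1
    ext j
    have : ¬ (j + N < N) := by omega
    simp [this, hg]
  simp_rw [key]
  have hfin : ∑' n, ENNReal.ofReal (g n) ≠ ⊤ := by
    rw [← ENNReal.ofReal_tsum_of_nonneg hnn hs]
    exact ENNReal.ofReal_ne_top
  have h := ENNReal.tendsto_sum_nat_add (fun n => ENNReal.ofReal (g n)) hfin
  have h' := (ENNReal.tendsto_toReal ENNReal.zero_ne_top).comp h
  rw [ENNReal.toReal_zero] at h'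
  exact h'

/-! ### Holomorphic functions: the Taylor series at `0` -/

/-- The Taylor coefficient `a_n = f^{(n)}(0)/n!`. -/
noncomputable abbrev taylorCoeff (f : ℂ → ℂ) (n : ℕ) : ℂ := (n ! : ℂ)⁻¹ * iteratedDeriv n f 0

/-- **Every holomorphic function on `𝔻` is its Taylor series** `Σ_n f^{(n)}(0)/n! · zⁿ` on `𝔻`
(Mathlib's `Complex.hasSum_taylorSeries_on_ball`). -/
theorem hasSum_taylor (f : ℂ → ℂ) (hf : DifferentiableOn ℂ f (ball 0 1)) :
    ∀ z ∈ ball (0 : ℂ) 1, HasSum (fun n => taylorCoeff f n * z ^ n) (f z) := by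
  intro z hz
  refine (Complex.hasSum_taylorSeries_on_ball hf hz).congr_fun fun n => ?_
  simp only [taylorCoeff, smul_eq_mul, sub_zero]
  ring

/-- **Parseval for holomorphic `f ∈ A_k`**: `⟨f, f⟩_k = Σ_n |f^{(n)}(0)/n!|² ⟨zⁿ, zⁿ⟩_k`. -/
theorem hasSum_pairing_self_taylor (k : ℕ) (hk : 2 ≤ k) (f : ℂ → ℂ)
    (hf : DifferentiableOn ℂ f (ball 0 1))
    (hint : IntegrableOn (fun z => ‖f z‖ ^ 2 * (1 - ‖z‖ ^ 2) ^ (k - 2)) (ball (0 : ℂ) 1)) :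
    HasSum (fun n => ‖taylorCoeff f n‖ ^ 2 * monomialNormSq k n) (pairing k f f).re :=
  hasSum_pairing_self k hk _ f (hasSum_taylor f hf) hint

/-- **The Taylor polynomials of a holomorphic `f ∈ A_k` converge to `f` in the pairing norm**: the
monomials — Rühl's `(5-98)` — span a dense subspace, i.e. form an orthonormal BASIS after
normalisation (`T5BergmanMonomialNorm.ruhlInner_basis`). -/
theorem tendsto_pairing_sub_taylor (k : ℕ) (hk : 2 ≤ k) (f : ℂ → ℂ)
    (hf : DifferentiableOn ℂ f (ball 0 1))
    (hint : IntegrableOn (fun z => ‖f z‖ ^ 2 * (1 - ‖z‖ ^ 2) ^ (k - 2)) (ball (0 : ℂ) 1)) :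
    Tendsto (fun N => (pairing k (f - partialSum (taylorCoeff f) N)
      (f - partialSum (taylorCoeff f) N)).re) atTop (𝓝 0) :=
  tendsto_pairing_sub_partialSum k hk _ f (hasSum_taylor f hf) hint

end Summit.Ventures.HodgeRepro2.T5BergmanParseval
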